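import Literature.AlgebraicTopology.SingularHomology.ExcisionTheorem
import Literature.AlgebraicTopology.SingularHomology.TripleSequence
import HarnessLib

/-!
# Localisation of the homology action of a self-map which is the identity on an open set — by EXCISION, with no
# hypothesis on the overlap (the variation principle of Picard–Lefschetz theory; Hatcher §2.1, AGZV II §1.1)

Layer `Literature/AlgebraicTopology/SingularHomology`; theorems only (no definition, no named fact). Written by the
prover seat `hodge-nonav-prover-Ax` (g9) for the programme "localisation of the nodal meridian monodromy" (route
`Summits/HodgeConjecture/HodgeConjecture/Theses/CyclicUnitaryPowers.lean`, crux K1). Companion of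
`CohomologySelfMapFixingOpenSet` (Mayer–Vietoris form, which needs `H^q(A ∩ B) = 0`); the present form needs NOTHING
about `A ∩ B`.

**Setting.** `X = A ∪ B` an open cover, `h : X → X` continuous with `h = id` on `B` and `h(A) ⊆ A`.

**Results** (coefficients: any commutative ring `R`, module `M`):
* `relativeSingularHomology.map_eq_self_of_eqOn` — `h_* = id` on `Hₙ(X, A; M)`: by excision
  `Hₙ(B, A ∩ B) → Hₙ(X, A)` is onto (`isIso_map_of_interior_union_interior_holds`) and `h ∘ ι_B = ι_B`;
* `singularHomology.map_sub_self_mem_range_of_eqOn` — **`h_* x − x ∈ im (Hₙ(A) → Hₙ(X))` for every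
  `x ∈ Hₙ(X; M)`** (exactness of `Hₙ(A) → Hₙ(X) → Hₙ(X, A)`, `exact_map_ofAbsolute`): the VARIATION of `h` factors
  through the local piece `A` ("`h_{γ*} = id + var_γ ∘ i_*`", AGZV II §1.1);
* `singularHomology.map_pow_map_subsetIncl` — `h_*^i ∘ ι_{A*} = ι_{A*} ∘ (h_A)_*^i`;
* `singularHomology.sum_smul_pow_map_sub_self_eq_zero_of_eqOn` — a polynomial relation `Σ_i c_i (h_A)_*^i = 0` on
  `Hₙ(A)` gives `(Σ_i c_i h_*^i)(h_* x − x) = 0` for all `x ∈ Hₙ(X)`;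
* `singularHomology.finrank_range_sub_id_le_of_eqOn` — `rank (h_* − 1) ≤ dim Hₙ(A)` when `Hₙ(A)` is finite-dimensional.

## References

* [HatcherAT2002] A. Hatcher, Algebraic Topology, CUP 2002, §2.1 Thm. 2.13 ff. (exact sequence of the pair), Thm.
  2.20 (excision).
* [ArnoldGuseinzadeVarchenko2012] V. I. Arnold, S. M. Gusein-Zade, A. N. Varchenko, Singularities of Differentiable
  Maps, Vol. 2, Part I §1.1 (variation operator; held text p0013, p0025).
-/

noncomputable section

open CategoryTheory Limits Set

universe u v

namespace Literature.AlgebraicTopology.SingularHomology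

variable (R : Type v) [CommRing R] (M : Type v) [AddCommGroup M] [Module R M]
  {X : Type u} [TopologicalSpace X]

namespace relativeSingularHomology

/-- **A self-map which is the identity on `B` acts trivially on `Hₙ(X, A)`** for an open cover `X = A ∪ B` with
`h(A) ⊆ A`: every relative class comes from `(B, A ∩ B)` by excision, where `h` is the identity.
[cite: HatcherAT2002, §2.1 Thm. 2.20] -/
theorem map_eq_self_of_eqOn {A B : Set X} (hAo : IsOpen A) (hBo : IsOpen B) (hAB : A ∪ B = univ)
    (h : C(X, X)) (hB : ∀ x ∈ B, h x = x) (hA : Set.MapsTo h A A) (n : ℕ)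
    (r : relativeSingularHomology R M X A n) : map R M h hA n r = r := by
  have hint : interior A ∪ interior B = univ := by rw [hAo.interior_eq, hBo.interior_eq, hAB]
  haveI := isIso_map_of_interior_union_interior_holds R M X A B hint n
  obtain ⟨s, rfl⟩ := (ModuleCat.epi_iff_surjective (map R M (X := ↥B) (subsetIncl B)
    (Set.mapsTo_preimage Subtype.val A : Set.MapsTo _ (Subtype.val ⁻¹' A) A) n)).1 inferInstance r
  rw [← ModuleCat.comp_apply, ← map_comp]
  have hc : h.comp (subsetIncl B) = subsetIncl B := by
    ext b
    exact hB b b.2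
  rw [map_congr R M hc]

end relativeSingularHomology

namespace singularHomology

/-- **The variation of a self-map fixing `B` pointwise factors through the local piece `A`**: for an open cover
`X = A ∪ B`, `h = id` on `B`, `h(A) ⊆ A`, and every `x ∈ Hₙ(X; M)`, `h_* x − x ∈ im (ι_{A*} : Hₙ(A) → Hₙ(X))`
(`j_*(h_* x − x) = h_* j_* x − j_* x = 0` in `Hₙ(X, A)`, and `ker j_* = im ι_{A*}`).
[cite: HatcherAT2002, §2.1 Thm. 2.13 ff. and Thm. 2.20] [cite: ArnoldGuseinzadeVarchenko2012, Part I §1.1 (held text p0013)] -/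
theorem map_sub_self_mem_range_of_eqOn {A B : Set X} (hAo : IsOpen A) (hBo : IsOpen B) (hAB : A ∪ B = univ)
    (h : C(X, X)) (hB : ∀ x ∈ B, h x = x) (hA : Set.MapsTo h A A) (n : ℕ) (x : singularHomology R M X n) :
    map R M h n x - x ∈ LinearMap.range (map R M (subsetIncl A) n).hom := by
  have hex := (relativeSingularHomology.exact_map_ofAbsolute R M A n).moduleCat_range_eq_ker
  change map R M h n x - x ∈ LinearMap.range (map R M (⟨Subtype.val, continuous_subtype_val⟩ : C(↥A, X)) n).hom
  rw [hex, LinearMap.mem_ker]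
  change relativeSingularHomology.ofAbsolute R M X A n (map R M h n x - x) = 0
  rw [map_sub, ← ModuleCat.comp_apply, ← relativeSingularHomology.ofAbsolute_comp_map R M h hA n,
    ModuleCat.comp_apply, relativeSingularHomology.map_eq_self_of_eqOn R M hAo hBo hAB h hB hA, sub_self]

/-- **Naturality along the invariant piece**: `h_* (ι_{A*} a) = ι_{A*} ((h_A)_* a)` for the restriction `h_A` of `h`
to `A`. [cite: HatcherAT2002, §2.1] -/
theorem map_map_subsetIncl {A : Set X} (h : C(X, X)) (hA : C(↥A, ↥A)) (hhA : ∀ a : ↥A, ((hA a : ↥A) : X) = h a)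
    (n : ℕ) (a : singularHomology R M (↥A) n) :
    map R M h n (map R M (subsetIncl A) n a) = map R M (subsetIncl A) n (map R M hA n a) := by
  have hc : h.comp (subsetIncl A) = (subsetIncl A).comp hA := by
    ext a
    exact (hhA a).symm
  rw [← ModuleCat.comp_apply, ← map_comp, hc, map_comp, ModuleCat.comp_apply]

/-- Iterated naturality: `h_*^i (ι_{A*} a) = ι_{A*} ((h_A)_*^i a)`. [cite: HatcherAT2002, §2.1] -/
theorem map_pow_map_subsetIncl {A : Set X} (h : C(X, X)) (hA : C(↥A, ↥A)) (hhA : ∀ a : ↥A, ((hA a : ↥A) : X) = h a)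
    (n i : ℕ) (a : singularHomology R M (↥A) n) :
    ((map R M h n).hom ^ i) (map R M (subsetIncl A) n a) = map R M (subsetIncl A) n (((map R M hA n).hom ^ i) a) := by
  induction i generalizing a with
  | zero => rw [pow_zero, pow_zero, Module.End.one_apply, Module.End.one_apply]
  | succ i ih =>
    rw [pow_succ, pow_succ, Module.End.mul_apply, Module.End.mul_apply]
    have h1 : (map R M h n).hom (map R M (subsetIncl A) n a) = map R M (subsetIncl A) n (map R M hA n a) :=
      map_map_subsetIncl R M h hA hhA n a
    rw [h1, ih]

/-- **Polynomial relations of the local action kill the variation**: if `Σ_{i<m} c_i (h_A)_*^i = 0` on `Hₙ(A)` then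
`(Σ_{i<m} c_i h_*^i)(h_* x − x) = 0` for every `x ∈ Hₙ(X)` (the variation lies in `ι_{A*} Hₙ(A)`).
[cite: HatcherAT2002, §2.1 Thm. 2.13 ff. and Thm. 2.20] [cite: ArnoldGuseinzadeVarchenko2012, Part I §1.1 (held text p0013)] -/
theorem sum_smul_pow_map_sub_self_eq_zero_of_eqOn {A B : Set X} (hAo : IsOpen A) (hBo : IsOpen B)
    (hAB : A ∪ B = univ) (h : C(X, X)) (hB : ∀ x ∈ B, h x = x) (hA : C(↥A, ↥A))
    (hhA : ∀ a : ↥A, ((hA a : ↥A) : X) = h a) (n : ℕ) {m : ℕ} (c : ℕ → R)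
    (hsum : ∀ a : singularHomology R M (↥A) n, ∑ i ∈ Finset.range m, c i • ((map R M hA n).hom ^ i) a = 0)
    (x : singularHomology R M X n) :
    ∑ i ∈ Finset.range m, c i • ((map R M h n).hom ^ i) (map R M h n x - x) = 0 := by
  have hmaps : Set.MapsTo h A A := fun a ha => by
    have := (hA ⟨a, ha⟩).2
    rwa [hhA ⟨a, ha⟩] at this
  obtain ⟨a, ha⟩ := map_sub_self_mem_range_of_eqOn R M hAo hBo hAB h hB hmaps n x
  rw [← ha]
  change ∑ i ∈ Finset.range m, c i • ((map R M h n).hom ^ i) (map R M (subsetIncl A) n a) = 0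
  rw [Finset.sum_congr rfl fun i _ => by rw [map_pow_map_subsetIncl R M h hA hhA n i a, ← map_smul],
    ← map_sum, hsum a, map_zero]

/-- **`rank (h_* − 1) ≤ dim Hₙ(A)`**: the variation of a self-map fixing `B` pointwise has image in
`ι_{A*} Hₙ(A; M)`. [cite: HatcherAT2002, §2.1 Thm. 2.13 ff. and Thm. 2.20] -/
theorem finrank_range_sub_id_le_of_eqOn [Nontrivial R] {A B : Set X} (hAo : IsOpen A) (hBo : IsOpen B)
    (hAB : A ∪ B = univ) (h : C(X, X)) (hB : ∀ x ∈ B, h x = x) (hA : Set.MapsTo h A A) (n : ℕ)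
    [Module.Finite R (singularHomology R M (↥A) n)] :
    Module.finrank R ↥(LinearMap.range ((map R M h n).hom - LinearMap.id)) ≤
      Module.finrank R (singularHomology R M (↥A) n) := by
  have hle : LinearMap.range ((map R M h n).hom - LinearMap.id) ≤ LinearMap.range (map R M (subsetIncl A) n).hom := by
    rintro _ ⟨x, rfl⟩
    exact map_sub_self_mem_range_of_eqOn R M hAo hBo hAB h hB hA n x
  exact (Submodule.finrank_mono hle).trans (LinearMap.finrank_range_le _)

end singularHomology

end Literature.AlgebraicTopology.SingularHomology

end
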